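import Summits.FinalStateConjecture.FinalStateConjecture.Theorems.SoloBlindOrientationCauchy
import Summits.FinalStateConjecture.FinalStateConjecture.Theorems.SoloBlindDispersalSettles

/-!
# Solo (blind) — rung r1b, final shape: the recorded consequence form plus (b′) and (c)

`SoloBlindDispersalSettles` reduced rung r1b of the solo ladder ("small data disperse, in the typed
sense of `FinalStateConjecture`") to the hypothesis `SoloBlindTiedMinkowskiStability`: the corrected
consequence form of the stability of Minkowski space (Christodoulou–Klainerman 1993 / Bieri 2010,
recorded as text in the module docstring of
`Literature.Geometry.Lorentzian.MinkowskiStabilityCauchy`)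
with its last conjunct `ConvergesToMinkowski univ k` strengthened by (c) the TIE of the late chart
to the data and (d) the future ORIENTATION of chart time. `SoloBlindOrientationCauchy` then proved
(d) from (c) and `C⁰`-smallness of the deviation (`SoloBlindTiedFlatChart.ofDeviationLe`).

This file records the resulting final shape of the named analytic input of rung r1b, as a
HYPOTHESIS (`SoloBlindSmallTiedMinkowskiStability`, a `Prop`, never asserted): for the data class
of the recorded fact, every maximal vacuum Cauchy development has complete `𝓘⁺` and a late-time
embedding `Ψ` of its whole carrier (`SoloBlindSmallTiedChart`) which
(a)–(b) converges to `η` in `C²` — verbatim the recorded conjunct `ConvergesToMinkowski univ 2`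
with its chart exposed (`SoloBlindSmallTiedChart.convergesToMinkowski`) —,
(b′) is `1/10`-close to `η` in `C⁰` from `τ₀` on, in the SAME chart — the recorded
`RemainsCloseToMinkowski univ 0 (1/10)` quantifies its own chart
(`SoloBlindSmallTiedChart.remainsCloseToMinkowski`) —, and
(c) is tied: `Ψ({x⁰ > τ₀}) ⊆ J⁺(ι X)`.
Consequences: `SoloBlindSmallTiedMinkowskiStability → SoloBlindTiedMinkowskiStability`
(`soloBlindTiedMinkowskiStability_of_small`), hence the data of the class settle
(`soloBlind_settles_of_smallTiedMinkowskiStability`) and every maximal development disperses with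
`N = 0` (`soloBlind_disperses_of_smallTiedMinkowskiStability`).

What separates the hypothesis from the recorded consequence form is now exactly (b′) + (c): both are
read off the printed proofs — the solutions are constructed on the leaves `t ≥ 0` of a maximal time
function in the future of the initial maximal hypersurface, with global pointwise bounds on the
deviation from `η` (Christodoulou–Klainerman 1993, Thm. 10.2.1 and Proof 10.2.1, pp. 237–243;
Bieri 2010, Thm. 3, arXiv:0904.0620 p. 10) — and neither is derivable from the recorded form:
a boosted flat chart of Minkowski space satisfies (a), (b), (b′) and fails (c) for every `τ₀`
(module docstring of `SoloBlindDispersal`, gap F1), and (b′) does not follow from (b) by raising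
`τ₀`, the covering clause of `IsLateEmbedding` at a later time being out of reach.

References: D. Christodoulou, S. Klainerman, *The global nonlinear stability of the Minkowski
space*, Princeton 1993, Thm. 1.0.3 (p. 20), Thm. 10.2.1 (pp. 237–243); L. Bieri, J. Differential
Geom. 86 (2010) 17–70, Thm. 3 (arXiv:0904.0620, p. 10); Y. Choquet-Bruhat, R. Geroch, Commun.
Math. Phys. 14 (1969), Thm. 3 (p. 332).
-/

noncomputable section

open Literature.Geometry.Lorentzian TopologicalSpace Manifold Filter Topology Set Function
open scoped ContDiff Topology ENNReal

namespace Summit.FinalStateConjecture.FinalStateConjecture.Theorems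

section Development

variable {X : Type} [TopologicalSpace X] [ChartedSpace E3 X] [IsManifold (𝓡 3) ∞ X]
  [ConnectedSpace X] {D : InitialDataSet (𝓡 3) X}

/-- **A small tied late flat chart** of a Cauchy development `𝒟`: a chart time `τ₀` and a
late-time embedding `Ψ` of the whole carrier after `τ₀` (a) whose `C²` deviation from `η` on the
slabs `{x⁰ = τ}` tends to `0` (b), whose `C⁰` deviation is at most `1/10` on every slab with
`τ ≥ τ₀` (b′), and whose late region `Ψ({x⁰ > τ₀})` lies in `J⁺(ι X)` (c). No orientation clause.
Christodoulou–Klainerman 1993, Thm. 10.2.1; Bieri 2010, Thm. 3. -/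
def SoloBlindSmallTiedChart (𝒟 : CauchyDevelopment D) : Prop :=
  ∃ (τ₀ : ℝ) (Ψ : Minkowski.background.domain → 𝒟.carrier),
    𝒟.toSpacetime.IsLateEmbedding Minkowski.background univ τ₀ Ψ ∧
      Tendsto (fun τ ↦ 𝒟.toSpacetime.deviationCk Minkowski.background Ψ 2 τ) atTop (𝓝 0) ∧
        (∀ τ, τ₀ ≤ τ →
          𝒟.toSpacetime.deviationCk Minkowski.background Ψ 0 τ ≤ ENNReal.ofReal (1 / 10)) ∧
          Ψ '' Minkowski.background.lateRegion τ₀ ⊆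
            𝒟.metric.causalFuture 𝒟.timeOrientation (range 𝒟.embed)

namespace SoloBlindSmallTiedChart

variable {𝒟 : CauchyDevelopment D}

/-- Items (a)–(b) are the recorded conjunct: convergence to Minkowski space in `C²` on the whole
carrier. Christodoulou–Klainerman 1993, Thm. 10.2.1. -/
theorem convergesToMinkowski (h : SoloBlindSmallTiedChart 𝒟) :
    𝒟.toSpacetime.ConvergesToMinkowski univ 2 := by
  obtain ⟨τ₀, Ψ, hemb, hlim, -, -⟩ := h
  exact ⟨τ₀, Ψ, hemb, hlim⟩

/-- Items (a), (b′) give `1/10`-closeness to Minkowski space in `C⁰` on the whole carrier.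
Christodoulou–Klainerman 1993, Thm. 1.0.2. -/
theorem remainsCloseToMinkowski (h : SoloBlindSmallTiedChart 𝒟) :
    𝒟.toSpacetime.RemainsCloseToMinkowski univ 0 (ENNReal.ofReal (1 / 10)) := by
  obtain ⟨τ₀, Ψ, hemb, -, hsmall, -⟩ := h
  exact ⟨τ₀, Ψ, hemb, hsmall⟩

/-- **A small tied chart is a tied flat chart in `C²`**: the orientation clause (d) of
`SoloBlindTiedFlatChart` follows from (b′) and (c) (`SoloBlindTiedFlatChart.ofDeviationLe`, i.e.
the Cauchy-hypersurface argument of `SoloBlindOrientationCauchy`). -/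
theorem nonempty_tiedFlatChart (h : SoloBlindSmallTiedChart 𝒟) :
    Nonempty (SoloBlindTiedFlatChart 𝒟 2) := by
  obtain ⟨τ₀, Ψ, hemb, hlim, hsmall, htie⟩ := h
  exact ⟨SoloBlindTiedFlatChart.ofDeviationLe 𝒟 τ₀ Ψ hemb hlim hsmall htie⟩

end SoloBlindSmallTiedChart

/-- **Packaging with (d) discharged**: a vacuum Cauchy development with complete `𝓘⁺` and a small
tied late flat chart satisfies the "settles down" conjunct of `FinalStateConjecture` (`N = 0`,
`O = J⁺(ι X)`). Christodoulou–Klainerman 1993, Thm. 1.0.3. -/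
theorem soloBlind_conclusion_of_smallTiedChart (𝒟 : VacuumCauchyDevelopment D)
    (hI : HasCompleteNullInfinity 𝒟.toCauchyDevelopment)
    (h : SoloBlindSmallTiedChart 𝒟.toCauchyDevelopment) :
    HasCompleteNullInfinity 𝒟.toCauchyDevelopment ∧
      ∃ (O : Set 𝒟.carrier) (d : FinalStateDecomposition 𝒟.toSpacetime O 2),
        (∀ i, Kerr.IsSubextremal (d.mass i) (d.spin i)) ∧
          O = exteriorOf 𝒟.toCauchyDevelopment d.charted ∧
            RaysStayInClosure 𝒟.toCauchyDevelopment O ∧ HasExhaustiveCharts d ∧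
              IsFutureOriented d := by
  obtain ⟨c⟩ := h.nonempty_tiedFlatChart
  exact soloBlind_conclusion_of_tiedFlatChart 𝒟 hI c

end Development

/-- **Hypothesis (NOT asserted): small tied stability of Minkowski space.** For every vacuum,
maximal datum on `ℝ³` with the Christodoulou–Klainerman fall-off, `ε`-close to the trivial datum in
`dataWeightedSobolevEDist s δ`, `δ ∈ (-3/2, -1/2)` (the data class of the recorded fact
`christodoulou_klainerman_bieri_stability_minkowski_cauchy`), every maximal vacuum Cauchy
development has complete `𝓘⁺` and a small tied late flat chart (`SoloBlindSmallTiedChart`: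
the recorded `C²`-convergence, plus `C⁰`-closeness from `τ₀` in the same chart, plus the tie).
Christodoulou–Klainerman 1993, Thm. 10.2.1; Bieri 2010, Thm. 3. -/
def SoloBlindSmallTiedMinkowskiStability : Prop :=
  ∃ (s : ℕ), ∃ δ ∈ Set.Ioo (-3 / 2 : ℝ) (-1 / 2), ∃ ε > (0 : ℝ),
    ∀ (D : InitialDataSet 𝓘(ℝ, E3) Minkowski.slice) [D.metric.HasLeviCivita],
      D.IsVacuumConstraintSolution → D.IsMaximalData →
      (∃ M : ℝ, trivialAFEnd.IsStronglyAsymptoticallyFlatCK D M) →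
      InitialDataSet.dataWeightedSobolevEDist s δ D trivialData < ENNReal.ofReal ε →
      ∀ 𝒟 : VacuumCauchyDevelopment D, 𝒟.IsMaximal →
        HasCompleteNullInfinity 𝒟.toCauchyDevelopment ∧
          SoloBlindSmallTiedChart 𝒟.toCauchyDevelopment

/-- The small tied form implies the tied form of `SoloBlindDispersalSettles` (orientation derived).
Christodoulou–Klainerman 1993, Thm. 10.2.1. -/
theorem soloBlindTiedMinkowskiStability_of_small (h : SoloBlindSmallTiedMinkowskiStability) :
    SoloBlindTiedMinkowskiStability := by
  obtain ⟨s, δ, hδ, ε, hε, H⟩ := h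
  refine ⟨s, δ, hδ, ε, hε, fun D _ hvac hmax hCK hsmall 𝒟 h𝒟 ↦ ?_⟩
  obtain ⟨hI, hc⟩ := H D hvac hmax hCK hsmall 𝒟 h𝒟
  exact ⟨hI, hc.nonempty_tiedFlatChart⟩

/-- The small tied form implies the recorded shape of the last two conjuncts of the consequence
form: complete `𝓘⁺` and `ConvergesToMinkowski univ 2` for every maximal development — it is a
strengthening of the recorded statement (minus causal geodesic completeness) by (b′) and (c) only.
Christodoulou–Klainerman 1993, Thm. 1.0.3. -/
theorem soloBlind_recordedShape_of_small (h : SoloBlindSmallTiedMinkowskiStability) :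
    ∃ (s : ℕ), ∃ δ ∈ Set.Ioo (-3 / 2 : ℝ) (-1 / 2), ∃ ε > (0 : ℝ),
      ∀ (D : InitialDataSet 𝓘(ℝ, E3) Minkowski.slice) [D.metric.HasLeviCivita],
        D.IsVacuumConstraintSolution → D.IsMaximalData →
        (∃ M : ℝ, trivialAFEnd.IsStronglyAsymptoticallyFlatCK D M) →
        InitialDataSet.dataWeightedSobolevEDist s δ D trivialData < ENNReal.ofReal ε →
        ∀ 𝒟 : VacuumCauchyDevelopment D, 𝒟.IsMaximal →
          HasCompleteNullInfinity 𝒟.toCauchyDevelopment ∧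
            𝒟.toSpacetime.ConvergesToMinkowski univ 2 := by
  obtain ⟨s, δ, hδ, ε, hε, H⟩ := h
  refine ⟨s, δ, hδ, ε, hε, fun D _ hvac hmax hCK hsmall 𝒟 h𝒟 ↦ ?_⟩
  obtain ⟨hI, hc⟩ := H D hvac hmax hCK hsmall 𝒟 h𝒟
  exact ⟨hI, hc.convergesToMinkowski⟩

/-- **Rung r1b, final shape ⇒ the data settle**: under `SoloBlindSmallTiedMinkowskiStability`
and MGHD existence (`choquetBruhat_geroch_exists_mghd_cauchy`), every datum of the Bieri–CK
smallness class on `ℝ³` satisfies `SoloBlindSettles`. Christodoulou–Klainerman 1993, Thm. 1.0.3;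
Choquet-Bruhat–Geroch 1969, Thm. 3. -/
theorem soloBlind_settles_of_smallTiedMinkowskiStability
    (h : SoloBlindSmallTiedMinkowskiStability) (hCBG : choquetBruhat_geroch_exists_mghd_cauchy) :
    ∃ (s : ℕ), ∃ δ ∈ Set.Ioo (-3 / 2 : ℝ) (-1 / 2), ∃ ε > (0 : ℝ),
      ∀ (D : InitialDataSet 𝓘(ℝ, E3) Minkowski.slice) [D.metric.HasLeviCivita],
        D.IsVacuumConstraintSolution → D.IsMaximalData →
        (∃ M : ℝ, trivialAFEnd.IsStronglyAsymptoticallyFlatCK D M) →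
        InitialDataSet.dataWeightedSobolevEDist s δ D trivialData < ENNReal.ofReal ε →
        SoloBlindSettles Minkowski.slice D :=
  soloBlind_settles_of_tiedMinkowskiStability (soloBlindTiedMinkowskiStability_of_small h) hCBG

/-- **The dispersive development directly, final shape**: under the small tied form, every maximal
vacuum Cauchy development of a datum of the class has complete `𝓘⁺` and an `N = 0` final state
decomposition of `O = J⁺(ι X)` satisfying all clauses of the statement.
Christodoulou–Klainerman 1993, Thm. 1.0.3 ("the solution disperses"). -/
theorem soloBlind_disperses_of_smallTiedMinkowskiStability
    (h : SoloBlindSmallTiedMinkowskiStability) :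
    ∃ (s : ℕ), ∃ δ ∈ Set.Ioo (-3 / 2 : ℝ) (-1 / 2), ∃ ε > (0 : ℝ),
      ∀ (D : InitialDataSet 𝓘(ℝ, E3) Minkowski.slice) [D.metric.HasLeviCivita],
        D.IsVacuumConstraintSolution → D.IsMaximalData →
        (∃ M : ℝ, trivialAFEnd.IsStronglyAsymptoticallyFlatCK D M) →
        InitialDataSet.dataWeightedSobolevEDist s δ D trivialData < ENNReal.ofReal ε →
        ∀ 𝒟 : VacuumCauchyDevelopment D, 𝒟.IsMaximal →
          HasCompleteNullInfinity 𝒟.toCauchyDevelopment ∧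
            ∃ d : FinalStateDecomposition 𝒟.toSpacetime
                (soloBlindDataFuture 𝒟.toCauchyDevelopment) 2,
              d.N = 0 ∧ soloBlindDataFuture 𝒟.toCauchyDevelopment =
                  exteriorOf 𝒟.toCauchyDevelopment d.charted ∧
                RaysStayInClosure 𝒟.toCauchyDevelopment
                    (soloBlindDataFuture 𝒟.toCauchyDevelopment) ∧
                  HasExhaustiveCharts d ∧ IsFutureOriented d :=
  soloBlind_disperses_of_tiedMinkowskiStability (soloBlindTiedMinkowskiStability_of_small h)

end Summit.FinalStateConjecture.FinalStateConjecture.Theorems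

end
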